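import Summits.CriticalPhenomena.CardyFormulaZ2.Theses.CardyPolygonWords
import Summits.CriticalPhenomena.CardyFormulaZ2.Theorems.CardyBoundaryCoulombGasAssembly
import Summits.CriticalPhenomena.CardyFormulaZ2.Theorems.CardyGluingRDEPolygonReductionLatticePolygon

/-!
# `Assembly` of route CardyPolygonWords of `CardyFormulaZ2` (= `PolygonReduction` of route CardyGluingRDE)

Item stmt-CriticalPhenomena-4784: **Cardy's formula for bond-`ℤ²` at `p = 1/2` in every LATTICE
polygon with LATTICE marks (`CardyLatticePolygon`) implies it in every conformal rectangle**
(`cardyFormulaZ2_of_cardyLatticePolygon`), whence `CardyPolygonWords_Assembly_proof`; the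
identical decl `CardyGluingRDE.PolygonReduction` follows by the same term (sibling file
`CardyGluingRDEPolygonReduction.lean`, which imports the CardyGluingRDE route file).

Proof. The tree's construction-free Bollobás–Riordan sandwich for the G02 discretisation
(`RectilinearApproximation.cardyFormulaZ2_of_rectilinearCardy`: stubs A/B/D1/D2/D3 of crux
LoopsToCrossings, `discreteCrossing_subset_of_lower`, `discreteCrossing_subset_plate`,
`bond_le_one_sub_real_openCrossing`, Radó continuity) is re-run with a lattice-polygon approximant
`P` of the lower/upper comparison quads `Q`, `N` in place of the rectilinear one. The only new
point: the marks of `P` are lattice points, hence only `τ`-CLOSE to those of `Q` (not equal); the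
quads are therefore re-marked with the marks of `P` (same Jordan domain), which moves each arc
within the `r/2`-fattening of the old one (uniform continuity of the boundary loop,
`arc_subset_cthickening_arc_of_marks`), so the comparison clauses hold with room `r/2`.
-/

noncomputable section

namespace Summit.CriticalPhenomena.CardyFormulaZ2.Theorems

namespace LatticePolygonApproximation

open Set Metric List Filter Topology MeasureTheory
open Literature.Probability.LatticeModels Literature.Probability.Percolation
open Literature.Probability.RandomPlanarGeometry
open Summit.CriticalPhenomena.CardyFormulaZ2.Cruxes.LoopsToCrossings.OracleSandwich
  (stub_discreteCrossing_of_pathIn stub_not_discreteCrossing_of_dualPathIn stub_cardyContinuity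
    stub_comparisonGeometry stub_cyclicFlip)
open Summit.CriticalPhenomena.CardyFormulaZ2.Theorems.RectilinearApproximation
  (discreteCrossing_subset_of_lower discreteCrossing_subset_plate bond_le_one_sub_real_openCrossing)

/-- The next mark of a re-marked conformal rectangle moves by at most the displacement of the
marks. [folklore] -/
theorem abs_nextMark_sub_nextMark_le (Q Q' : ConformalRectangle) {τ₀ : ℝ}
    (hmk : ∀ i, |Q'.mark i - Q.mark i| ≤ τ₀) (i : Fin 4) :
    |Q'.nextMark i - Q.nextMark i| ≤ τ₀ := by
  unfold MarkedDomain.nextMark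
  split_ifs with h
  · exact hmk _
  · have := hmk ⟨0, by omega⟩
    rwa [add_sub_add_right_eq_sub]

/-- **Re-marking moves arcs little.** If `Q'` has the boundary loop of `Q` and marks `τ₀`-close
to those of `Q`, and `τ₀`-close parameters have `ω`-close boundary points, then every arc of
`Q'` lies in the closed `ω`-fattening of the corresponding arc of `Q`. [folklore] -/
theorem arc_subset_cthickening_arc_of_marks (Q Q' : ConformalRectangle)
    (hbd : Q'.boundary = Q.boundary) {τ₀ ω : ℝ}
    (hmk : ∀ i, |Q'.mark i - Q.mark i| ≤ τ₀)
    (hcont : ∀ s t : ℝ, |s - t| ≤ τ₀ → dist (Q.boundary s) (Q.boundary t) < ω) (i : Fin 4) :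
    Q'.arc i ⊆ cthickening ω (Q.arc i) := by
  rintro z ⟨t, ⟨ht1, ht2⟩, rfl⟩
  rw [hbd]
  have hmn : Q.mark i ≤ Q.nextMark i := (Q.mark_lt_nextMark i).le
  have h1 := abs_le.1 (hmk i)
  have h2 := abs_le.1 (abs_nextMark_sub_nextMark_le Q Q' hmk i)
  -- clamp `t` to the parameter interval of `Q.arc i`
  set t' := max (Q.mark i) (min t (Q.nextMark i)) with ht'
  have ht'mem : t' ∈ Icc (Q.mark i) (Q.nextMark i) :=
    ⟨le_max_left _ _, max_le hmn (min_le_right _ _)⟩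
  have htt' : |t - t'| ≤ τ₀ := by
    rw [abs_le]
    constructor
    · -- `t' ≤ t + τ₀`
      rcases le_total (Q.mark i) (min t (Q.nextMark i)) with h | h
      · rw [ht', max_eq_right h]; have := min_le_left t (Q.nextMark i); linarith
      · rw [ht', max_eq_left h]; linarith
    · -- `t - τ₀ ≤ t'`
      have : min t (Q.nextMark i) ≤ t' := le_max_right _ _
      rcases le_total t (Q.nextMark i) with h | h
      · rw [min_eq_left h] at this; linarith [(abs_nonneg _ ).trans (hmk i)]
      · rw [min_eq_right h] at this; linarith
  exact mem_cthickening_of_dist_le _ _ ω _ (mem_image_of_mem _ ht'mem) (hcont t t' htt').le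

/-- **`CardyLatticePolygon → CardyFormulaZ2`.** Cardy's formula for bond-`ℤ²` at `p = 1/2` in
every lattice polygon with lattice marks implies it in every conformal rectangle. See the module
docstring. [cite: BollobasRiordan2006, Ch. 7 Lemma 14 p. 184, Claims 19–20 p. 192, remark p. 195] -/
theorem cardyFormulaZ2_of_cardyLatticePolygon
    (hLP : Summit.CriticalPhenomena.CardyFormulaZ2.Theses.CardyPolygonWords.CardyLatticePolygon) :
    _root_.CardyFormulaZ2 := by
  intro R φ x hux
  set L : ℝ := Literature.Probability.RandomPlanarGeometry.cardyFunction (crossRatio x) with hL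
  -- the cyclically re-marked copy and the two continuity moduli
  obtain ⟨R₂, _hcar, hbd, hmk, hflip⟩ := stub_cyclicFlip R
  obtain ⟨φ₂, x₂, hux₂⟩ := MarkedDomain.exists_isUniformizing_holds R₂
  -- lower bound
  have hlow : ∀ e : ℝ, 0 < e → ∀ᶠ δ : ℝ in 𝓝[>] 0, L - e < bondDomainCrossingProb R δ := by
    intro e he
    obtain ⟨ε₁, hε₁, h1⟩ := stub_cardyContinuity R φ x hux (e / 3) (by positivity)
    obtain ⟨m, hm, hgeo⟩ := stub_comparisonGeometry R (ε₁ / 2) (by positivity)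
    obtain ⟨δ₀, hδ₀, t₀, ht₀, hAfor⟩ := stub_discreteCrossing_of_pathIn R
    obtain ⟨⟨Q, r, hr, hQb, hQm, hL1, hL2, hL3, hL4⟩, -⟩ := hgeo t₀ ht₀
    -- uniform continuity of `∂Q` at scale `r/2`
    obtain ⟨τ₀, hτ₀, -, hτ₀c⟩ := Q.toJordanDomain.exists_forall_dist_boundary_lt (ε := r / 2) (by positivity)
    obtain ⟨P, d, hd, hPcell, hPpt, hPmark, hPclose⟩ :=
      exists_latticePolygon_close Q (ε := min (ε₁ / 2) (r / 4)) (τ := min (ε₁ / 2) τ₀)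
        (lt_min (by positivity) (by positivity)) (lt_min (by positivity) hτ₀)
    -- the re-marked lower quad
    set Q' : ConformalRectangle := ⟨Q.toJordanDomain, P.mark, P.strictMono_mark, P.mark_mem⟩ with hQ'
    have harc : ∀ i, Q'.arc i ⊆ cthickening (r / 2) (Q.arc i) := fun i =>
      arc_subset_cthickening_arc_of_marks Q Q' rfl
        (fun j => (hPmark j).trans (min_le_right _ _)) hτ₀c i
    have hthick : ∀ i, cthickening (r / 2) (Q'.arc i) ⊆ cthickening r (Q.arc i) := by
      intro i z hz
      have h1 := cthickening_subset_of_subset (r / 2) (harc i) hz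
      have h2 := cthickening_cthickening_subset (by positivity : (0 : ℝ) ≤ r / 2)
        (by positivity : (0 : ℝ) ≤ r / 2) (Q.arc i) h1
      rwa [add_halves] at h2
    have hL1' : ∀ z ∈ cthickening (r / 2) Q'.carrier, z ∉ R.carrier →
        infDist z (R.arc 0) ≤ t₀ ∨ infDist z (R.arc 2) ≤ t₀ :=
      fun z hz => hL1 z (cthickening_mono (by linarith) _ hz)
    have hL2' : ∀ z ∈ cthickening (r / 2) Q'.carrier, z ∈ R.carrier →
        m ≤ infDist z (R.arc 1) ∧ m ≤ infDist z (R.arc 3) :=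
      fun z hz => hL2 z (cthickening_mono (by linarith) _ hz)
    have hL3' : ∀ z ∈ cthickening (r / 2) (Q'.arc 0), z ∉ R.carrier ∧ infDist z (R.arc 0) ≤ t₀ :=
      fun z hz => hL3 z (hthick 0 hz)
    have hL4' : ∀ z ∈ cthickening (r / 2) (Q'.arc 2), z ∉ R.carrier ∧ infDist z (R.arc 2) ≤ t₀ :=
      fun z hz => hL4 z (hthick 2 hz)
    obtain ⟨ψ, y, hψ⟩ := MarkedDomain.exists_isUniformizing_holds P
    have hF : |Literature.Probability.RandomPlanarGeometry.cardyFunction (crossRatio y) - L| ≤ e / 3 := by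
      refine h1 P (fun u => ?_) (fun i => ?_) ψ y hψ
      · calc dist (P.boundary u) (R.boundary u)
            ≤ dist (P.boundary u) (Q.boundary u) + dist (Q.boundary u) (R.boundary u) := dist_triangle _ _ _
          _ ≤ min (ε₁ / 2) (r / 4) + ε₁ / 2 := add_le_add (hPclose u) (hQb u)
          _ ≤ ε₁ := by have := min_le_left (ε₁ / 2) (r / 4); linarith
      · calc |P.mark i - R.mark i| ≤ |P.mark i - Q.mark i| + |Q.mark i - R.mark i| := abs_sub_le _ _ _
          _ ≤ min (ε₁ / 2) τ₀ + ε₁ / 2 := add_le_add (hPmark i) (hQm i)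
          _ ≤ ε₁ := by have := min_le_left (ε₁ / 2) τ₀; linarith
    have hPlim : Tendsto (bondDomainCrossingProb P) (𝓝[>] 0)
        (𝓝 (Literature.Probability.RandomPlanarGeometry.cardyFunction (crossRatio y))) :=
      hLP P ⟨d, hd, hPcell, hPpt⟩ ψ y hψ
    have hev1 : ∀ᶠ δ : ℝ in 𝓝[>] 0,
        Literature.Probability.RandomPlanarGeometry.cardyFunction (crossRatio y) - e / 3 <
          bondDomainCrossingProb P δ :=
      hPlim.eventually (lt_mem_nhds (by linarith))
    have hev2 : ∀ᶠ δ : ℝ in 𝓝[>] 0, δ ∈ Ioo 0 (min δ₀ (min m (r / 4))) :=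
      Ioo_mem_nhdsGT (lt_min hδ₀ (lt_min hm (by positivity)))
    filter_upwards [hev1, hev2] with δ hδ1 hδ2
    have hδ₀' : δ < δ₀ := hδ2.2.trans_le (min_le_left _ _)
    have hδm : δ < m := hδ2.2.trans_le ((min_le_right _ _).trans (min_le_left _ _))
    have hδr : δ < r / 4 := hδ2.2.trans_le ((min_le_right _ _).trans (min_le_right _ _))
    have hincl := discreteCrossing_subset_of_lower R Q' P hAfor hL1' hL2' hL3' hL4' hPclose (fun _ => rfl)
      (le_min (by positivity) (by positivity)) (by have := min_le_right (ε₁ / 2) (r / 4); linarith)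
      hδ2.1 hδ₀' hδm (by linarith) ht₀.le
    have hle : bondDomainCrossingProb P δ ≤ bondDomainCrossingProb R δ := by
      rw [bondDomainCrossingProb_eq_measureReal, bondDomainCrossingProb_eq_measureReal]
      exact measureReal_mono hincl
    have hF' := (abs_sub_le_iff.1 hF).2
    linarith
  -- upper bound
  have hup : ∀ e : ℝ, 0 < e → ∀ᶠ δ : ℝ in 𝓝[>] 0, bondDomainCrossingProb R δ < L + e := by
    intro e he
    obtain ⟨ε₂, hε₂, h2⟩ := stub_cardyContinuity R₂ φ₂ x₂ hux₂ (e / 3) (by positivity)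
    obtain ⟨m, hm, hgeo⟩ := stub_comparisonGeometry R (ε₂ / 2) (by positivity)
    obtain ⟨δ₀, hδ₀, t₀, ht₀, hBfor⟩ := stub_not_discreteCrossing_of_dualPathIn R m hm
    obtain ⟨-, ⟨N, r, hr, hNb, hNm, hU1, hU2, hU3, hU4, hU5⟩⟩ := hgeo t₀ ht₀
    -- uniform continuity of `∂N` at scale `r/2`
    obtain ⟨τ₀, hτ₀, -, hτ₀c⟩ := N.toJordanDomain.exists_forall_dist_boundary_lt (ε := r / 2) (by positivity)
    obtain ⟨P, d, hd, hPcell, hPpt, hPmark, hPclose⟩ :=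
      exists_latticePolygon_close N (ε := min (ε₂ / 2) (r / 8)) (τ := min (ε₂ / 2) τ₀)
        (lt_min (by positivity) (by positivity)) (lt_min (by positivity) hτ₀)
    -- the re-marked upper quad
    set N' : ConformalRectangle := ⟨N.toJordanDomain, P.mark, P.strictMono_mark, P.mark_mem⟩ with hN'
    have harc : ∀ i, N'.arc i ⊆ cthickening (r / 2) (N.arc i) := fun i =>
      arc_subset_cthickening_arc_of_marks N N' rfl
        (fun j => (hPmark j).trans (min_le_right _ _)) hτ₀c i
    have hthick : ∀ i, cthickening (r / 2) (N'.arc i) ⊆ cthickening r (N.arc i) := by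
      intro i z hz
      have h1 := cthickening_subset_of_subset (r / 2) (harc i) hz
      have h2 := cthickening_cthickening_subset (by positivity : (0 : ℝ) ≤ r / 2)
        (by positivity : (0 : ℝ) ≤ r / 2) (N.arc i) h1
      rwa [add_halves] at h2
    have hU1' : ∀ z ∈ cthickening (r / 2) N'.carrier, z ∉ R.carrier →
        infDist z (R.arc 1) ≤ t₀ ∨ infDist z (R.arc 3) ≤ t₀ :=
      fun z hz => hU1 z (cthickening_mono (by linarith) _ hz)
    have hU2' : ∀ z ∈ cthickening (r / 2) N'.carrier, z ∈ R.carrier →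
        m ≤ infDist z (R.arc 0) ∧ m ≤ infDist z (R.arc 2) :=
      fun z hz => hU2 z (cthickening_mono (by linarith) _ hz)
    have hU3' : ∀ z ∈ cthickening (r / 2) N'.carrier, z ∈ R.carrier → ∀ j : Fin 4, m ≤ dist z (R.pt j) :=
      fun z hz => hU3 z (cthickening_mono (by linarith) _ hz)
    have hU4' : ∀ z ∈ cthickening (r / 2) (N'.arc 0), z ∉ R.carrier ∧ infDist z (R.arc 1) ≤ t₀ :=
      fun z hz => hU4 z (hthick 0 hz)
    have hU5' : ∀ z ∈ cthickening (r / 2) (N'.arc 2), z ∉ R.carrier ∧ infDist z (R.arc 3) ≤ t₀ :=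
      fun z hz => hU5 z (hthick 2 hz)
    obtain ⟨ψ, y, hψ⟩ := MarkedDomain.exists_isUniformizing_holds P
    have hF : |Literature.Probability.RandomPlanarGeometry.cardyFunction (crossRatio y) - (1 - L)| ≤ e / 3 := by
      rw [← hflip φ x φ₂ x₂ hux hux₂]
      refine h2 P (fun u => ?_) (fun i => ?_) ψ y hψ
      · rw [hbd u]
        calc dist (P.boundary u) (R.boundary (u + R.mark 1))
            ≤ dist (P.boundary u) (N.boundary u) + dist (N.boundary u) (R.boundary (u + R.mark 1)) :=
              dist_triangle _ _ _
          _ ≤ min (ε₂ / 2) (r / 8) + ε₂ / 2 := add_le_add (hPclose u) (hNb u)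
          _ ≤ ε₂ := by have := min_le_left (ε₂ / 2) (r / 8); linarith
      · rw [hmk i]
        calc |P.mark i - ![0, R.mark 2 - R.mark 1, R.mark 3 - R.mark 1, R.mark 0 + 1 - R.mark 1] i|
            ≤ |P.mark i - N.mark i| +
                |N.mark i - ![0, R.mark 2 - R.mark 1, R.mark 3 - R.mark 1, R.mark 0 + 1 - R.mark 1] i| :=
              abs_sub_le _ _ _
          _ ≤ min (ε₂ / 2) τ₀ + ε₂ / 2 := add_le_add (hPmark i) (hNm i)
          _ ≤ ε₂ := by have := min_le_left (ε₂ / 2) τ₀; linarith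
    have hPlim : Tendsto (bondDomainCrossingProb P) (𝓝[>] 0)
        (𝓝 (Literature.Probability.RandomPlanarGeometry.cardyFunction (crossRatio y))) :=
      hLP P ⟨d, hd, hPcell, hPpt⟩ ψ y hψ
    have hev1 : ∀ᶠ δ : ℝ in 𝓝[>] 0,
        Literature.Probability.RandomPlanarGeometry.cardyFunction (crossRatio y) - e / 3 <
          bondDomainCrossingProb P δ :=
      hPlim.eventually (lt_mem_nhds (by linarith))
    have hev2 : ∀ᶠ δ : ℝ in 𝓝[>] 0, δ ∈ Ioo 0 (min δ₀ (min (m / 3) (r / 8))) :=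
      Ioo_mem_nhdsGT (lt_min hδ₀ (lt_min (by positivity) (by positivity)))
    filter_upwards [hev1, hev2] with δ hδ1 hδ2
    have hδ₀' : δ < δ₀ := hδ2.2.trans_le (min_le_left _ _)
    have hδm : δ < m / 3 := hδ2.2.trans_le ((min_le_right _ _).trans (min_le_left _ _))
    have hδr : δ < r / 8 := hδ2.2.trans_le ((min_le_right _ _).trans (min_le_right _ _))
    have hle := bond_le_one_sub_real_openCrossing R hBfor hU1' hU2' hU3' hU4' hU5' hδ2.1 hδ₀'
      (by linarith) (by linarith) ht₀.le le_rfl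
    have hincl := discreteCrossing_subset_plate N' P (r := r / 2) (ρ := min (ε₂ / 2) (r / 8)) (δ := δ)
      hPclose (fun _ => rfl)
      (le_min (by positivity) (by positivity)) (by have := min_le_right (ε₂ / 2) (r / 8); linarith)
      hδ2.1 (by linarith)
    have hle' : bondDomainCrossingProb P δ ≤ (bondPercolation (zdGraph 2) half).real
        (openCrossing {x : Site 2 | meshPoint δ x ∈ cthickening (r / 2 / 2) N'.carrier}
          {x | meshPoint δ x ∈ cthickening (r / 2 / 2) (N'.arc 0)}
          {x | meshPoint δ x ∈ cthickening (r / 2 / 2) (N'.arc 2)}) := by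
      rw [bondDomainCrossingProb_eq_measureReal]
      exact measureReal_mono hincl
    have hF' := (abs_sub_le_iff.1 hF).2
    linarith
  rw [Metric.tendsto_nhds]
  intro e he
  filter_upwards [hlow e he, hup e he] with δ hδ1 hδ2
  rw [Real.dist_eq, abs_sub_lt_iff]
  constructor <;> linarith

end LatticePolygonApproximation

/-- **`Assembly`** of route CardyPolygonWords (the same item stmt-CriticalPhenomena-4784, same
term): `CardyLatticePolygon → CardyFormulaZ2`. [folklore] -/
theorem CardyPolygonWords_Assembly_proof :
    Summit.CriticalPhenomena.CardyFormulaZ2.Theses.CardyPolygonWords.Assembly :=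
  fun h => LatticePolygonApproximation.cardyFormulaZ2_of_cardyLatticePolygon h

end Summit.CriticalPhenomena.CardyFormulaZ2.Theorems
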